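import Literature.Analysis.FluidPDE.TimePeriodicNSLattice
import Literature.Analysis.FluidPDE.FourierL2PicardDifference
import Literature.Analysis.FunctionSpaces.TorusSobolevNormEmbeddingProofs
import Literature.Analysis.FunctionSpaces.SobolevProductLawFourier
import HarnessLib

/-!
# Time-periodic Navier–Stokes on `T³` in space–time Fourier coefficients, IV: parabolic
# bootstrap — solutions of the lattice equations are rapidly decreasing
# (Iooss 1972; Henry 1981, Ch. 8; Kielhöfer 2012, §I.8)

Analysis/FluidPDE proof file (theorems only; no definitions, no named facts), sequel of
`TimePeriodicNSLattice` on the discharge path of `Literature.Analysis.FluidPDE.PeriodicNSOrbitPersists`.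
The persistence step produces solutions `x` of the projected lattice equation only in the
maximal-regularity class `W ⊂ ℓ²(ℤ × ℤ³)` (`∑ |x|² = ∑ Λ²|v̂|² < ∞`, `Λ(n,k) = |n| + |k|²`); to
return to CLASSICAL (smooth) time-periodic solutions, and to identify the kernel and the range of
the linearisation with the PDE hypotheses (i)/(ii) of the fact, one needs that such solutions —
of the nonlinear equation and of the linearised equations with smooth coefficients and smooth
right-hand sides — have rapidly decreasing coefficients. This is the Fourier side of parabolic
regularity, proved here by a **fractional bootstrap**:

* §A real powers of the parabolic weight (`Λ(m)^p ≤ 4^p (Λ(m')^p + Λ(m−m')^p)`), the scalar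
  inequality `b^{2θ−1}/a ≤ a^{2θ−2} + b^{2θ−2}` and the finiteness of the gain constant
  `S_θ = ∑_{k ≠ 0} |k|^{4θ−4}` for `θ < 1/4` (the lattice `p`-series of
  `Torus.summable_one_add_freqNormSq_rpow_neg_of_lt`);
* §B the two gain kernels `Λ'^{2θ−2}⟨k''⟩²Λ''⁻²` and `Λ'⁻²⟨k''⟩²Λ''^{2θ−2}` have `∑_{m'}` bounded
  by `6 S_θ`, `12 S_θ` uniformly in `m` (sum in `n'` first: only the `p = 2` integer series of
  `TimePeriodicNSLattice` is needed, the fractional powers enter through suprema);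
* §C the **`θ`-gain estimate**: for families `x`, `y` vanishing on the zero spatial modes and
  `p ≥ 0`,
  `∑_m Λ^{2(p+θ)} ‖N(x/Λ, y/Λ)(m)‖² ≲ (∑Λ^{2p}|x|²)(∑|y|²) + (∑|x|²)(∑Λ^{2p}|y|²)`
  — the convective term of two fields of parabolic regularity `1 + p` has regularity
  `p + θ − 1 + 1`, a gain of `θ` over what the equation consumes;
* §D the **bootstrap**: if `c‖x(m)‖ ≤ ‖y(m)‖ + ‖N(x/Λ,x/Λ)(m)‖ + ‖N(x₀/Λ,x/Λ)(m)‖ + ‖N(x/Λ,x₀/Λ)(m)‖`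
  off `k = 0` with `x ∈ ℓ²` and `x₀`, `y` rapidly decreasing (all moments `∑ Λ^N |·|² < ∞`), then
  `x` is rapidly decreasing. This covers at once the nonlinear equation (`x₀ = 0`) and the
  linearised equations `T h = 0`, `T h = e` at a smooth orbit (`x₀ = ` the orbit).

## References

* G. Iooss, Arch. Rational Mech. Anal. 47 (1972) 301–329 (function spaces of §2). [Iooss1972]
* D. Henry, *Geometric Theory of Semilinear Parabolic Equations*, LNM 840 (1981), Ch. 8 with
  §3.5 (smoothing of the semiflow). [Henry1981]
* H. Kielhöfer, *Bifurcation Theory*, 2nd ed. (2012), §I.8 (PDF pp. 59–60): regularity of the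
  `2π/κ`-periodic solutions ("by a bootstrapping argument"). [Kielhofer2012]
-/

noncomputable section

open scoped BigOperators Topology ENNReal NNReal ComplexConjugate
open Filter Set Function MeasureTheory

namespace Literature.Analysis.FluidPDE

namespace TimePeriodicLattice

open Literature.Analysis.FunctionSpaces Literature.Analysis.FunctionSpaces.Torus
open Literature.Analysis.FunctionSpaces.EuclideanSpace
open Literature.Analysis.FluidPDE.ScalarFourier

-- BODY START
-- NOTATION START
/-- Local notation: the parabolic weight `Λ(n, k) = |n| + |k|²`. -/
local notation:max "Λ" m:max => (|((Prod.fst m : ℤ) : ℝ)| + freqNormSq (Prod.snd m))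

/-- Local notation: the convective symbol on `ℤ × ℤ³` (as in `TimePeriodicNSLattice`). -/
local notation:max "𝐍[" a ", " b "]" m:max =>
  (WithLp.toLp 2 (fun p : Fin 3 => ∑ j : Fin 3, ∑' m' : ℤ × (Fin 3 → ℤ),
    a m' j * (dsym j (Prod.snd m - Prod.snd m') * b (m - m') p)) : EuclideanSpace ℂ (Fin 3))

/-- Local notation: division by the weight (as in `TimePeriodicNSLattice`). -/
local notation:max "𝐜" x:max => (fun mm : ℤ × (Fin 3 → ℤ) =>
  ((((|((Prod.fst mm : ℤ) : ℝ)| + freqNormSq (Prod.snd mm))⁻¹ : ℝ) : ℂ) • x mm))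
-- NOTATION END

/-! ## §A‴ Real powers of the parabolic weight -/

section Rpow

/-- `0 ≤ Λ(m)^p`. [folklore] -/
theorem wt_rpow_nonneg (p : ℝ) (m : ℤ × (Fin 3 → ℤ)) : 0 ≤ (Λ m) ^ p :=
  Real.rpow_nonneg (wt_nonneg m) p

/-- `Λ(m)^{2q} = (Λ(m)^q)²`. [folklore] -/
theorem wt_rpow_two_mul (q : ℝ) (m : ℤ × (Fin 3 → ℤ)) : (Λ m) ^ (2 * q) = ((Λ m) ^ q) ^ 2 := by
  rw [mul_comm, Real.rpow_mul (wt_nonneg m), Real.rpow_two]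

/-- `Λ(m)^{2q} = (Λ(m)^q)²` inside `ENNReal.ofReal`. [folklore] -/
theorem ofReal_wt_rpow_two_mul (q : ℝ) (m : ℤ × (Fin 3 → ℤ)) :
    ENNReal.ofReal ((Λ m) ^ (2 * q)) = ENNReal.ofReal ((Λ m) ^ q) ^ 2 := by
  rw [wt_rpow_two_mul, ENNReal.ofReal_pow (wt_rpow_nonneg q m)]

/-- **Splitting of real powers of the weight**: `Λ(m)^p ≤ 4^p (Λ(m')^p + Λ(m − m')^p)` for
`p ≥ 0` (`Λ(m) ≤ 2Λ(m') + 2Λ(m−m') ≤ 4 max`). [folklore] -/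
theorem wt_rpow_le {p : ℝ} (hp : 0 ≤ p) (m m' : ℤ × (Fin 3 → ℤ)) :
    (Λ m) ^ p ≤ (4 : ℝ) ^ p * ((Λ m') ^ p + (Λ (m - m')) ^ p) := by
  have h := wt_le_two_mul_add m m'
  have ha := wt_nonneg m'
  have hb := wt_nonneg (m - m')
  have hpa := Real.rpow_nonneg ha p
  have hpb := Real.rpow_nonneg hb p
  rcases le_total (Λ m') (Λ (m - m')) with hab | hab
  · have h1 : Λ m ≤ 4 * Λ (m - m') := by linarith
    calc (Λ m) ^ p ≤ (4 * Λ (m - m')) ^ p := Real.rpow_le_rpow (wt_nonneg m) h1 hp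
      _ = (4 : ℝ) ^ p * (Λ (m - m')) ^ p := Real.mul_rpow (by norm_num) hb
      _ ≤ (4 : ℝ) ^ p * ((Λ m') ^ p + (Λ (m - m')) ^ p) := by
          gcongr
          exact le_add_of_nonneg_left hpa
  · have h1 : Λ m ≤ 4 * Λ m' := by linarith
    calc (Λ m) ^ p ≤ (4 * Λ m') ^ p := Real.rpow_le_rpow (wt_nonneg m) h1 hp
      _ = (4 : ℝ) ^ p * (Λ m') ^ p := Real.mul_rpow (by norm_num) ha
      _ ≤ (4 : ℝ) ^ p * ((Λ m') ^ p + (Λ (m - m')) ^ p) := by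
          gcongr
          exact le_add_of_nonneg_right hpb

/-- **Suprema in the time frequency**: `Λ(n, k)^s ≤ (|k|²)^s` for `s ≤ 0`, `k ≠ 0`. [folklore] -/
theorem wt_rpow_le_freqNormSq_rpow {s : ℝ} (hs : s ≤ 0) {m : ℤ × (Fin 3 → ℤ)} (hm : m.2 ≠ 0) :
    (Λ m) ^ s ≤ (freqNormSq m.2) ^ s :=
  Real.rpow_le_rpow_of_nonpos (by linarith [Torus.one_le_freqNormSq hm]) (freqNormSq_le_wt m) hs

/-- `Λ^q ≤ 1 + Λ^N` for `0 ≤ q ≤ N` (real versus integer moments). [folklore] -/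
theorem wt_rpow_le_one_add_pow {q : ℝ} (hq : 0 ≤ q) {N : ℕ} (hN : q ≤ N) (m : ℤ × (Fin 3 → ℤ)) :
    (Λ m) ^ q ≤ 1 + (Λ m) ^ N := by
  have h0 := wt_nonneg m
  by_cases h1 : 1 ≤ Λ m
  · calc (Λ m) ^ q ≤ (Λ m) ^ (N : ℝ) := Real.rpow_le_rpow_of_exponent_le h1 hN
      _ = (Λ m) ^ N := Real.rpow_natCast _ _
      _ ≤ 1 + (Λ m) ^ N := le_add_of_nonneg_left zero_le_one
  · calc (Λ m) ^ q ≤ 1 := Real.rpow_le_one h0 (not_le.1 h1).le hq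
      _ ≤ 1 + (Λ m) ^ N := le_add_of_nonneg_right (pow_nonneg h0 N)

/-- Real moments are controlled by integer moments:
`∑ Λ^{2q}|z|² ≤ ∑|z|² + ∑ Λ^N |z|²` for `0 ≤ 2q ≤ N`. [folklore] -/
theorem tsum_rpow_wt_mul_le {q : ℝ} (hq : 0 ≤ q) {N : ℕ} (hN : 2 * q ≤ N)
    (z : ℤ × (Fin 3 → ℤ) → EuclideanSpace ℂ (Fin 3)) :
    ∑' m, ENNReal.ofReal ((Λ m) ^ (2 * q)) * ‖z m‖ₑ ^ 2 ≤
      (∑' m, ‖z m‖ₑ ^ 2) + ∑' m, ENNReal.ofReal ((Λ m) ^ N) * ‖z m‖ₑ ^ 2 := by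
  rw [← ENNReal.tsum_add]
  refine ENNReal.tsum_le_tsum fun m => ?_
  have h := wt_rpow_le_one_add_pow (by linarith) hN m
  calc ENNReal.ofReal ((Λ m) ^ (2 * q)) * ‖z m‖ₑ ^ 2
      ≤ ENNReal.ofReal (1 + (Λ m) ^ N) * ‖z m‖ₑ ^ 2 := by gcongr
    _ = ‖z m‖ₑ ^ 2 + ENNReal.ofReal ((Λ m) ^ N) * ‖z m‖ₑ ^ 2 := by
        rw [ENNReal.ofReal_add zero_le_one (pow_nonneg (wt_nonneg m) N), ENNReal.ofReal_one, add_mul,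
          one_mul]

/-- Real moments of a family with all integer moments finite are finite. [folklore] -/
theorem tsum_rpow_wt_mul_ne_top {q : ℝ} (hq : 0 ≤ q) {z : ℤ × (Fin 3 → ℤ) → EuclideanSpace ℂ (Fin 3)}
    (hz : ∀ N : ℕ, ∑' m, ENNReal.ofReal ((Λ m) ^ N) * ‖z m‖ₑ ^ 2 ≠ ∞) :
    ∑' m, ENNReal.ofReal ((Λ m) ^ (2 * q)) * ‖z m‖ₑ ^ 2 ≠ ∞ := by
  obtain ⟨N, hN⟩ := exists_nat_ge (2 * q)
  have h0 : ∑' m, ‖z m‖ₑ ^ 2 ≠ ∞ := by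
    have := hz 0
    simpa only [pow_zero, ENNReal.ofReal_one, one_mul] using this
  exact ne_top_of_le_ne_top (ENNReal.add_ne_top.2 ⟨h0, hz N⟩) (tsum_rpow_wt_mul_le hq hN z)

/-- **The scalar inequality behind the second gain kernel**:
`b^{2θ−1} a⁻¹ ≤ a^{2θ−2} + b^{2θ−2}` for `a, b ≥ 1`, `θ ≤ 1/2` (if `b ≥ a` use
`b^{2θ−1} ≤ a^{2θ−1}`, else `a⁻¹ ≤ b⁻¹`). [folklore] -/
theorem rpow_mul_inv_le {θ a b : ℝ} (hθ : θ ≤ 1 / 2) (ha : 1 ≤ a) (hb : 1 ≤ b) :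
    b ^ (2 * θ - 1) * a⁻¹ ≤ a ^ (2 * θ - 2) + b ^ (2 * θ - 2) := by
  have ha0 : 0 < a := by linarith
  have hb0 : 0 < b := by linarith
  have hA : 0 ≤ a ^ (2 * θ - 2) := Real.rpow_nonneg ha0.le _
  have hB : 0 ≤ b ^ (2 * θ - 2) := Real.rpow_nonneg hb0.le _
  have hexp : (2 * θ - 1) + (-1) = 2 * θ - 2 := by ring
  have e1 : a ^ (2 * θ - 2) = a ^ (2 * θ - 1) * a⁻¹ := by
    rw [← Real.rpow_neg_one a, ← Real.rpow_add ha0, hexp]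
  have e2 : b ^ (2 * θ - 2) = b ^ (2 * θ - 1) * b⁻¹ := by
    rw [← Real.rpow_neg_one b, ← Real.rpow_add hb0, hexp]
  rcases le_total a b with hab | hab
  · have h1 : b ^ (2 * θ - 1) ≤ a ^ (2 * θ - 1) := Real.rpow_le_rpow_of_nonpos ha0 hab (by linarith)
    calc b ^ (2 * θ - 1) * a⁻¹ ≤ a ^ (2 * θ - 1) * a⁻¹ :=
          mul_le_mul_of_nonneg_right h1 (inv_nonneg.2 ha0.le)
      _ = a ^ (2 * θ - 2) := e1.symm
      _ ≤ a ^ (2 * θ - 2) + b ^ (2 * θ - 2) := le_add_of_nonneg_right hB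
  · have h1 : a⁻¹ ≤ b⁻¹ := inv_anti₀ hb0 hab
    calc b ^ (2 * θ - 1) * a⁻¹ ≤ b ^ (2 * θ - 1) * b⁻¹ :=
          mul_le_mul_of_nonneg_left h1 (Real.rpow_nonneg hb0.le _)
      _ = b ^ (2 * θ - 2) := e2.symm
      _ ≤ a ^ (2 * θ - 2) + b ^ (2 * θ - 2) := le_add_of_nonneg_left hA

/-- Pointwise comparison of the gain series with the lattice `p`-series:
`(|k|²)^{2θ−2} ≤ 4 (1 + |k|²)^{−(2−2θ)}` (junk `0` at `k = 0` on the left for `θ ≠ 1`). [folklore] -/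
theorem freqNormSq_rpow_le {θ : ℝ} (hθ0 : 0 ≤ θ) (hθ : θ < 1) (k : Fin 3 → ℤ) :
    (freqNormSq k) ^ (2 * θ - 2) ≤ 4 * (1 + freqNormSq k) ^ (-(2 - 2 * θ)) := by
  have e : (-(2 - 2 * θ)) = 2 * θ - 2 := by ring
  rw [e]
  by_cases hk : k = 0
  · subst hk
    rw [(Torus.freqNormSq_eq_zero_iff (0 : Fin 3 → ℤ)).2 rfl, Real.zero_rpow (by linarith), add_zero,
      Real.one_rpow]
    norm_num
  · have h1 : 1 ≤ freqNormSq k := Torus.one_le_freqNormSq hk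
    have h0 : 0 < freqNormSq k := by linarith
    have h2 : (2 * freqNormSq k) ^ (2 * θ - 2) ≤ (1 + freqNormSq k) ^ (2 * θ - 2) :=
      Real.rpow_le_rpow_of_nonpos (by linarith) (by linarith) (by linarith)
    rw [Real.mul_rpow (by norm_num) h0.le] at h2
    have h3 : (1 / 4 : ℝ) ≤ (2 : ℝ) ^ (2 * θ - 2) := by
      have h4 : (2 : ℝ) ^ (-2 : ℝ) ≤ (2 : ℝ) ^ (2 * θ - 2) :=
        Real.rpow_le_rpow_of_exponent_le (by norm_num) (by linarith)
      have h5 : (2 : ℝ) ^ (-2 : ℝ) = 1 / 4 := by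
        rw [Real.rpow_neg (by norm_num), Real.rpow_two]; norm_num
      rwa [h5] at h4
    have h6 := Real.rpow_nonneg h0.le (2 * θ - 2)
    nlinarith

/-- **The gain constant is finite**: `S_θ = ∑_{k ∈ ℤ³} (|k|²)^{2θ−2} < ∞` for `θ < 1/4`
(`4 − 4θ > 3`; `Torus.summable_one_add_freqNormSq_rpow_neg_of_lt`). [folklore] -/
theorem gainConst_ne_top {θ : ℝ} (hθ0 : 0 ≤ θ) (hθ : θ < 1 / 4) :
    ∑' k : (Fin 3 → ℤ), ENNReal.ofReal ((freqNormSq k) ^ (2 * θ - 2)) ≠ ∞ := by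
  have hs : (Fintype.card (Fin 3) : ℝ) < 2 * (2 - 2 * θ) := by
    rw [Fintype.card_fin]; push_cast; linarith
  have hsum := summable_one_add_freqNormSq_rpow_neg_of_lt (d := Fin 3) hs
  have hnn : ∀ k : Fin 3 → ℤ, 0 ≤ 4 * (1 + freqNormSq k) ^ (-(2 - 2 * θ)) := fun k =>
    mul_nonneg (by norm_num) (Real.rpow_nonneg (by linarith [freqNormSq_nonneg k]) _)
  have hle : ∑' k : (Fin 3 → ℤ), ENNReal.ofReal ((freqNormSq k) ^ (2 * θ - 2)) ≤
      ∑' k : (Fin 3 → ℤ), ENNReal.ofReal (4 * (1 + freqNormSq k) ^ (-(2 - 2 * θ))) :=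
    ENNReal.tsum_le_tsum fun k => ENNReal.ofReal_le_ofReal (freqNormSq_rpow_le hθ0 (by linarith) k)
  refine ne_top_of_le_ne_top ?_ hle
  rw [← ENNReal.ofReal_tsum_of_nonneg hnn (hsum.mul_left 4)]
  exact ENNReal.ofReal_ne_top

end Rpow

/-! ## §B‴ The two gain kernels -/

section Kernels

variable {θ : ℝ}

/-- The shifted one-dimensional sum: `∑_{n' ∈ ℤ} ((|n − n'| + a)²)⁻¹ ≤ 3/a` for `a ≥ 1`. [folklore] -/
theorem tsum_int_inv_sq_shift_le {a : ℝ} (ha : 1 ≤ a) (n : ℤ) :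
    ∑' n' : ℤ, ENNReal.ofReal (((|((n - n' : ℤ) : ℝ)| + a) ^ 2)⁻¹) ≤ ENNReal.ofReal (3 / a) := by
  have h := tsum_int_inv_sq_le ha
  rw [← (Equiv.subLeft n).tsum_eq] at h
  simpa only [Equiv.subLeft_apply] using h

/-- **Gain kernel A, sum in `n'`** (fractional weight on the first factor):
`∑_{n'} Λ(n',k')^{2θ−2} ⟨k−k'⟩² Λ(n−n',k−k')⁻² ≤ 6 (|k'|²)^{2θ−2}` for `k' ≠ 0`, `k − k' ≠ 0`,
`θ ≤ 1`. [folklore] -/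
theorem tsum_gainKernelA_fst_le (hθ1 : θ ≤ 1) (n : ℤ) {k k' : Fin 3 → ℤ} (hk' : k' ≠ 0)
    (hkk' : k - k' ≠ 0) :
    ∑' n' : ℤ, ENNReal.ofReal ((Λ (n', k')) ^ (2 * θ - 2) *
        (sobolevWeight 1 (k - k') ^ 2 * ((Λ ((n, k) - (n', k'))) ^ 2)⁻¹)) ≤
      ENNReal.ofReal (6 * (freqNormSq k') ^ (2 * θ - 2)) := by
  have ha : 1 ≤ freqNormSq k' := Torus.one_le_freqNormSq hk'
  have hb : 1 ≤ freqNormSq (k - k') := Torus.one_le_freqNormSq hkk'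
  have ha0 : 0 < freqNormSq k' := by linarith
  have hb0 : 0 < freqNormSq (k - k') := by linarith
  have hA0 : 0 ≤ (freqNormSq k') ^ (2 * θ - 2) := Real.rpow_nonneg ha0.le _
  have hpt : ∀ n' : ℤ, (Λ (n', k')) ^ (2 * θ - 2) *
      (sobolevWeight 1 (k - k') ^ 2 * ((Λ ((n, k) - (n', k'))) ^ 2)⁻¹) ≤
      (2 * (freqNormSq k') ^ (2 * θ - 2) * freqNormSq (k - k')) *
        (((|((n - n' : ℤ) : ℝ)| + freqNormSq (k - k')) ^ 2)⁻¹) := by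
    intro n'
    have h1 : (Λ (n', k')) ^ (2 * θ - 2) ≤ (freqNormSq k') ^ (2 * θ - 2) :=
      wt_rpow_le_freqNormSq_rpow (m := (n', k')) (by linarith) hk'
    have hw : sobolevWeight 1 (k - k') ^ 2 ≤ 2 * freqNormSq (k - k') :=
      SteadyLattice.sobolevWeight_one_sq_le hkk'
    have hL : ((Λ ((n, k) - (n', k'))) ^ 2)⁻¹ = (((|((n - n' : ℤ) : ℝ)| + freqNormSq (k - k')) ^ 2)⁻¹) := rfl
    rw [hL]
    have hx : 0 ≤ (((|((n - n' : ℤ) : ℝ)| + freqNormSq (k - k')) ^ 2)⁻¹) := by positivity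
    calc (Λ (n', k')) ^ (2 * θ - 2) *
          (sobolevWeight 1 (k - k') ^ 2 * (((|((n - n' : ℤ) : ℝ)| + freqNormSq (k - k')) ^ 2)⁻¹))
        ≤ (freqNormSq k') ^ (2 * θ - 2) *
          ((2 * freqNormSq (k - k')) * (((|((n - n' : ℤ) : ℝ)| + freqNormSq (k - k')) ^ 2)⁻¹)) :=
          mul_le_mul h1 (mul_le_mul_of_nonneg_right hw hx) (by positivity) hA0
      _ = (2 * (freqNormSq k') ^ (2 * θ - 2) * freqNormSq (k - k')) *
          (((|((n - n' : ℤ) : ℝ)| + freqNormSq (k - k')) ^ 2)⁻¹) := by ring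
  have hc0 : 0 ≤ 2 * (freqNormSq k') ^ (2 * θ - 2) * freqNormSq (k - k') := by positivity
  calc ∑' n' : ℤ, ENNReal.ofReal ((Λ (n', k')) ^ (2 * θ - 2) *
        (sobolevWeight 1 (k - k') ^ 2 * ((Λ ((n, k) - (n', k'))) ^ 2)⁻¹))
      ≤ ∑' n' : ℤ, ENNReal.ofReal (2 * (freqNormSq k') ^ (2 * θ - 2) * freqNormSq (k - k')) *
          ENNReal.ofReal (((|((n - n' : ℤ) : ℝ)| + freqNormSq (k - k')) ^ 2)⁻¹) := by
        refine ENNReal.tsum_le_tsum fun n' => ?_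
        rw [← ENNReal.ofReal_mul hc0]
        exact ENNReal.ofReal_le_ofReal (hpt n')
    _ = ENNReal.ofReal (2 * (freqNormSq k') ^ (2 * θ - 2) * freqNormSq (k - k')) *
          ∑' n' : ℤ, ENNReal.ofReal (((|((n - n' : ℤ) : ℝ)| + freqNormSq (k - k')) ^ 2)⁻¹) :=
        ENNReal.tsum_mul_left
    _ ≤ ENNReal.ofReal (2 * (freqNormSq k') ^ (2 * θ - 2) * freqNormSq (k - k')) *
          ENNReal.ofReal (3 / freqNormSq (k - k')) := by
        gcongr; exact tsum_int_inv_sq_shift_le hb n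
    _ = ENNReal.ofReal (6 * (freqNormSq k') ^ (2 * θ - 2)) := by
        rw [← ENNReal.ofReal_mul hc0]
        congr 1
        field_simp [hb0.ne']
        ring

/-- **Gain kernel B, sum in `n'`** (fractional weight on the second factor):
`∑_{n'} Λ(n',k')⁻² ⟨k−k'⟩² Λ(n−n',k−k')^{2θ−2} ≤ 6 ((|k'|²)^{2θ−2} + (|k−k'|²)^{2θ−2})` for
`k' ≠ 0`, `k − k' ≠ 0`, `θ ≤ 1/2` (`≤ 6|k−k'|^{4θ−2}/|k'|²` and `rpow_mul_inv_le`). [folklore] -/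
theorem tsum_gainKernelB_fst_le (hθ2 : θ ≤ 1 / 2) (n : ℤ) {k k' : Fin 3 → ℤ} (hk' : k' ≠ 0)
    (hkk' : k - k' ≠ 0) :
    ∑' n' : ℤ, ENNReal.ofReal (((Λ (n', k')) ^ 2)⁻¹ *
        (sobolevWeight 1 (k - k') ^ 2 * (Λ ((n, k) - (n', k'))) ^ (2 * θ - 2))) ≤
      ENNReal.ofReal (6 * ((freqNormSq k') ^ (2 * θ - 2) + (freqNormSq (k - k')) ^ (2 * θ - 2))) := by
  have ha : 1 ≤ freqNormSq k' := Torus.one_le_freqNormSq hk'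
  have hb : 1 ≤ freqNormSq (k - k') := Torus.one_le_freqNormSq hkk'
  have ha0 : 0 < freqNormSq k' := by linarith
  have hb0 : 0 < freqNormSq (k - k') := by linarith
  have hB0 : 0 ≤ (freqNormSq (k - k')) ^ (2 * θ - 2) := Real.rpow_nonneg hb0.le _
  have hpt : ∀ n' : ℤ, ((Λ (n', k')) ^ 2)⁻¹ *
      (sobolevWeight 1 (k - k') ^ 2 * (Λ ((n, k) - (n', k'))) ^ (2 * θ - 2)) ≤
      (2 * freqNormSq (k - k') * (freqNormSq (k - k')) ^ (2 * θ - 2)) *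
        (((|((n' : ℤ) : ℝ)| + freqNormSq k') ^ 2)⁻¹) := by
    intro n'
    have h1 : (Λ ((n, k) - (n', k'))) ^ (2 * θ - 2) ≤ (freqNormSq (k - k')) ^ (2 * θ - 2) :=
      wt_rpow_le_freqNormSq_rpow (m := (n, k) - (n', k')) (by linarith) hkk'
    have hw : sobolevWeight 1 (k - k') ^ 2 ≤ 2 * freqNormSq (k - k') :=
      SteadyLattice.sobolevWeight_one_sq_le hkk'
    have hL : ((Λ (n', k')) ^ 2)⁻¹ = (((|((n' : ℤ) : ℝ)| + freqNormSq k') ^ 2)⁻¹) := rfl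
    rw [hL]
    have hx : 0 ≤ (((|((n' : ℤ) : ℝ)| + freqNormSq k') ^ 2)⁻¹) := by positivity
    calc (((|((n' : ℤ) : ℝ)| + freqNormSq k') ^ 2)⁻¹) *
          (sobolevWeight 1 (k - k') ^ 2 * (Λ ((n, k) - (n', k'))) ^ (2 * θ - 2))
        ≤ (((|((n' : ℤ) : ℝ)| + freqNormSq k') ^ 2)⁻¹) *
          ((2 * freqNormSq (k - k')) * (freqNormSq (k - k')) ^ (2 * θ - 2)) := by
          refine mul_le_mul_of_nonneg_left ?_ hx
          exact mul_le_mul hw h1 (wt_rpow_nonneg _ _) (by positivity)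
      _ = (2 * freqNormSq (k - k') * (freqNormSq (k - k')) ^ (2 * θ - 2)) *
          (((|((n' : ℤ) : ℝ)| + freqNormSq k') ^ 2)⁻¹) := by ring
  have hc0 : 0 ≤ 2 * freqNormSq (k - k') * (freqNormSq (k - k')) ^ (2 * θ - 2) := by positivity
  -- `b · b^{2θ-2} = b^{2θ-1}`
  have hbb : freqNormSq (k - k') * (freqNormSq (k - k')) ^ (2 * θ - 2) =
      (freqNormSq (k - k')) ^ (2 * θ - 1) := by
    have e : 2 * θ - 1 = (2 * θ - 2) + 1 := by ring
    rw [e, Real.rpow_add_one hb0.ne', mul_comm]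
  calc ∑' n' : ℤ, ENNReal.ofReal (((Λ (n', k')) ^ 2)⁻¹ *
        (sobolevWeight 1 (k - k') ^ 2 * (Λ ((n, k) - (n', k'))) ^ (2 * θ - 2)))
      ≤ ∑' n' : ℤ, ENNReal.ofReal (2 * freqNormSq (k - k') * (freqNormSq (k - k')) ^ (2 * θ - 2)) *
          ENNReal.ofReal (((|((n' : ℤ) : ℝ)| + freqNormSq k') ^ 2)⁻¹) := by
        refine ENNReal.tsum_le_tsum fun n' => ?_
        rw [← ENNReal.ofReal_mul hc0]
        exact ENNReal.ofReal_le_ofReal (hpt n')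
    _ = ENNReal.ofReal (2 * freqNormSq (k - k') * (freqNormSq (k - k')) ^ (2 * θ - 2)) *
          ∑' n' : ℤ, ENNReal.ofReal (((|((n' : ℤ) : ℝ)| + freqNormSq k') ^ 2)⁻¹) :=
        ENNReal.tsum_mul_left
    _ ≤ ENNReal.ofReal (2 * freqNormSq (k - k') * (freqNormSq (k - k')) ^ (2 * θ - 2)) *
          ENNReal.ofReal (3 / freqNormSq k') := by
        gcongr; exact tsum_int_inv_sq_le ha
    _ = ENNReal.ofReal (6 * ((freqNormSq (k - k')) ^ (2 * θ - 1) * (freqNormSq k')⁻¹)) := by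
        rw [← ENNReal.ofReal_mul hc0, mul_assoc 2, hbb]
        congr 1
        rw [div_eq_mul_inv]
        ring
    _ ≤ ENNReal.ofReal (6 * ((freqNormSq k') ^ (2 * θ - 2) + (freqNormSq (k - k')) ^ (2 * θ - 2))) := by
        refine ENNReal.ofReal_le_ofReal ?_
        have := rpow_mul_inv_le hθ2 ha hb
        linarith

/-- **Gain kernel A, total**: `∑_{m'} [k'≠0, k''≠0] Λ'^{2θ−2}⟨k''⟩²Λ''⁻² ≤ 6 S_θ`,
`S_θ = ∑_k (|k|²)^{2θ−2}`. [folklore] -/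
theorem tsum_gainKernelA_le (hθ1 : θ ≤ 1) (m : ℤ × (Fin 3 → ℤ)) :
    ∑' m' : ℤ × (Fin 3 → ℤ), (if m'.2 = 0 ∨ m.2 - m'.2 = 0 then 0 else
        ENNReal.ofReal ((Λ m') ^ (2 * θ - 2) *
          (sobolevWeight 1 (m.2 - m'.2) ^ 2 * ((Λ (m - m')) ^ 2)⁻¹))) ≤
      6 * ∑' k : (Fin 3 → ℤ), ENNReal.ofReal ((freqNormSq k) ^ (2 * θ - 2)) := by
  obtain ⟨n, k⟩ := m
  set S : ℝ≥0∞ := ∑' k : (Fin 3 → ℤ), ENNReal.ofReal ((freqNormSq k) ^ (2 * θ - 2)) with hS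
  rw [ENNReal.tsum_prod', ENNReal.tsum_comm]
  have hinner : ∀ k' : Fin 3 → ℤ, (∑' n' : ℤ, (if ((n', k') : ℤ × (Fin 3 → ℤ)).2 = 0 ∨
      ((n, k) : ℤ × (Fin 3 → ℤ)).2 - ((n', k') : ℤ × (Fin 3 → ℤ)).2 = 0 then 0 else
        ENNReal.ofReal ((Λ (n', k')) ^ (2 * θ - 2) *
          (sobolevWeight 1 (((n, k) : ℤ × (Fin 3 → ℤ)).2 - ((n', k') : ℤ × (Fin 3 → ℤ)).2) ^ 2 *
            ((Λ ((n, k) - (n', k'))) ^ 2)⁻¹)))) ≤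
      6 * ENNReal.ofReal ((freqNormSq k') ^ (2 * θ - 2)) := by
    intro k'
    by_cases h : k' = 0 ∨ k - k' = 0
    · simp only [h, if_true, tsum_zero]
      exact bot_le
    · obtain ⟨hk', hkk'⟩ := not_or.1 h
      simp only [h, if_false]
      refine (tsum_gainKernelA_fst_le hθ1 n hk' hkk').trans ?_
      rw [ENNReal.ofReal_mul (by norm_num), ENNReal.ofReal_ofNat]
  calc ∑' (k' : Fin 3 → ℤ) (n' : ℤ), (if ((n', k') : ℤ × (Fin 3 → ℤ)).2 = 0 ∨
        ((n, k) : ℤ × (Fin 3 → ℤ)).2 - ((n', k') : ℤ × (Fin 3 → ℤ)).2 = 0 then 0 else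
        ENNReal.ofReal ((Λ (n', k')) ^ (2 * θ - 2) *
          (sobolevWeight 1 (((n, k) : ℤ × (Fin 3 → ℤ)).2 - ((n', k') : ℤ × (Fin 3 → ℤ)).2) ^ 2 *
            ((Λ ((n, k) - (n', k'))) ^ 2)⁻¹)))
      ≤ ∑' k' : Fin 3 → ℤ, 6 * ENNReal.ofReal ((freqNormSq k') ^ (2 * θ - 2)) :=
        ENNReal.tsum_le_tsum hinner
    _ = 6 * S := by rw [ENNReal.tsum_mul_left]

/-- **Gain kernel B, total**: `∑_{m'} [k'≠0, k''≠0] Λ'⁻²⟨k''⟩²Λ''^{2θ−2} ≤ 12 S_θ`. [folklore] -/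
theorem tsum_gainKernelB_le (hθ2 : θ ≤ 1 / 2) (m : ℤ × (Fin 3 → ℤ)) :
    ∑' m' : ℤ × (Fin 3 → ℤ), (if m'.2 = 0 ∨ m.2 - m'.2 = 0 then 0 else
        ENNReal.ofReal (((Λ m') ^ 2)⁻¹ *
          (sobolevWeight 1 (m.2 - m'.2) ^ 2 * (Λ (m - m')) ^ (2 * θ - 2)))) ≤
      12 * ∑' k : (Fin 3 → ℤ), ENNReal.ofReal ((freqNormSq k) ^ (2 * θ - 2)) := by
  obtain ⟨n, k⟩ := m
  set S : ℝ≥0∞ := ∑' k : (Fin 3 → ℤ), ENNReal.ofReal ((freqNormSq k) ^ (2 * θ - 2)) with hS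
  rw [ENNReal.tsum_prod', ENNReal.tsum_comm]
  have hinner : ∀ k' : Fin 3 → ℤ, (∑' n' : ℤ, (if ((n', k') : ℤ × (Fin 3 → ℤ)).2 = 0 ∨
      ((n, k) : ℤ × (Fin 3 → ℤ)).2 - ((n', k') : ℤ × (Fin 3 → ℤ)).2 = 0 then 0 else
        ENNReal.ofReal (((Λ (n', k')) ^ 2)⁻¹ *
          (sobolevWeight 1 (((n, k) : ℤ × (Fin 3 → ℤ)).2 - ((n', k') : ℤ × (Fin 3 → ℤ)).2) ^ 2 *
            (Λ ((n, k) - (n', k'))) ^ (2 * θ - 2))))) ≤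
      6 * ENNReal.ofReal ((freqNormSq k') ^ (2 * θ - 2)) +
        6 * ENNReal.ofReal ((freqNormSq (k - k')) ^ (2 * θ - 2)) := by
    intro k'
    by_cases h : k' = 0 ∨ k - k' = 0
    · simp only [h, if_true, tsum_zero]
      exact bot_le
    · obtain ⟨hk', hkk'⟩ := not_or.1 h
      simp only [h, if_false]
      refine (tsum_gainKernelB_fst_le hθ2 n hk' hkk').trans ?_
      have hA0 : 0 ≤ (freqNormSq k') ^ (2 * θ - 2) := Real.rpow_nonneg (freqNormSq_nonneg _) _
      have hB0 : 0 ≤ (freqNormSq (k - k')) ^ (2 * θ - 2) := Real.rpow_nonneg (freqNormSq_nonneg _) _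
      rw [ENNReal.ofReal_mul (by norm_num), ENNReal.ofReal_ofNat, ENNReal.ofReal_add hA0 hB0, mul_add]
  calc ∑' (k' : Fin 3 → ℤ) (n' : ℤ), (if ((n', k') : ℤ × (Fin 3 → ℤ)).2 = 0 ∨
        ((n, k) : ℤ × (Fin 3 → ℤ)).2 - ((n', k') : ℤ × (Fin 3 → ℤ)).2 = 0 then 0 else
        ENNReal.ofReal (((Λ (n', k')) ^ 2)⁻¹ *
          (sobolevWeight 1 (((n, k) : ℤ × (Fin 3 → ℤ)).2 - ((n', k') : ℤ × (Fin 3 → ℤ)).2) ^ 2 *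
            (Λ ((n, k) - (n', k'))) ^ (2 * θ - 2))))
      ≤ ∑' k' : Fin 3 → ℤ, (6 * ENNReal.ofReal ((freqNormSq k') ^ (2 * θ - 2)) +
          6 * ENNReal.ofReal ((freqNormSq (k - k')) ^ (2 * θ - 2))) := ENNReal.tsum_le_tsum hinner
    _ = 6 * S + 6 * S := by
        rw [ENNReal.tsum_add, ENNReal.tsum_mul_left, ENNReal.tsum_mul_left, hS]
        congr 2
        exact (Equiv.subLeft k).tsum_eq (fun j => ENNReal.ofReal ((freqNormSq j) ^ (2 * θ - 2)))
    _ = 12 * S := by rw [← add_mul]; norm_num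

end Kernels

/-! ## §C‴ The `θ`-gain estimate for the convective symbol -/

section Gain

variable {θ : ℝ}

/-- Scalar Fubini–translation: `∑_m ∑_{m'} (F m' G(m−m'))² = (∑ F²)(∑ G²)` in `ℝ≥0∞`. [folklore] -/
theorem tsum_tsum_mul_sq_eq (F G : ℤ × (Fin 3 → ℤ) → ℝ≥0∞) :
    ∑' (m : ℤ × (Fin 3 → ℤ)) (m' : ℤ × (Fin 3 → ℤ)), (F m' * G (m - m')) ^ 2 =
      (∑' m, F m ^ 2) * ∑' m, G m ^ 2 := by
  rw [ENNReal.tsum_comm, ← ENNReal.tsum_mul_right]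
  refine tsum_congr fun m' => ?_
  simp only [mul_pow]
  rw [ENNReal.tsum_mul_left]
  congr 1
  exact (Equiv.subRight m').tsum_eq (fun l => G l ^ 2)

/-- The vanishing of the majorant term on the zero spatial modes. [folklore] -/
theorem majorant_term_eq_zero (x y : ℤ × (Fin 3 → ℤ) → EuclideanSpace ℂ (Fin 3)) (hx : ∀ n : ℤ, x (n, 0) = 0)
    (hy : ∀ n : ℤ, y (n, 0) = 0) {m m' : ℤ × (Fin 3 → ℤ)} (h : m'.2 = 0 ∨ m.2 - m'.2 = 0) :
    ‖x m'‖ₑ * ‖y (m - m')‖ₑ = 0 := by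
  rcases h with h | h
  · have : x m' = 0 := by
      have := hx m'.1
      rwa [show ((m'.1, 0) : ℤ × (Fin 3 → ℤ)) = m' from Prod.ext rfl h.symm] at this
    simp [this]
  · have : y (m - m') = 0 := by
      have := hy (m - m').1
      rwa [show (((m - m').1, 0) : ℤ × (Fin 3 → ℤ)) = m - m' from
        Prod.ext rfl (by simpa using h.symm)] at this
    simp [this]

/-- **Weighted factorisation of the majorant**: for `p ≥ 0`, `θ ≥ 0` and families vanishing on
the zero spatial modes,
`Λ(m)^{p+θ} ‖(x/Λ)(m')‖ ⟨k''⟩ ‖(y/Λ)(m'')‖ ≤ 4^{p+θ} [ (Λ'^p‖x'‖ ‖y''‖) K_A + (‖x'‖ Λ''^p‖y''‖) K_B ]`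
with `K_A = Λ'^{θ−1}⟨k''⟩Λ''⁻¹`, `K_B = Λ'⁻¹⟨k''⟩Λ''^{θ−1}` off the zero modes. [folklore] -/
theorem gain_majorant_le {p : ℝ} (hp : 0 ≤ p) (hθ : 0 ≤ θ) (x y : ℤ × (Fin 3 → ℤ) → EuclideanSpace ℂ (Fin 3))
    (hx : ∀ n : ℤ, x (n, 0) = 0) (hy : ∀ n : ℤ, y (n, 0) = 0) (m m' : ℤ × (Fin 3 → ℤ)) :
    ENNReal.ofReal ((Λ m) ^ (p + θ)) *
        (‖(𝐜 x) m'‖ₑ * (ENNReal.ofReal (sobolevWeight 1 (m.2 - m'.2)) * ‖(𝐜 y) (m - m')‖ₑ)) ≤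
      ENNReal.ofReal ((4 : ℝ) ^ (p + θ)) *
        ((ENNReal.ofReal ((Λ m') ^ p) * ‖x m'‖ₑ * ‖y (m - m')‖ₑ) *
            (if m'.2 = 0 ∨ m.2 - m'.2 = 0 then 0 else
              ENNReal.ofReal ((Λ m') ^ (θ - 1) * (sobolevWeight 1 (m.2 - m'.2) * (Λ (m - m'))⁻¹))) +
          (‖x m'‖ₑ * (ENNReal.ofReal ((Λ (m - m')) ^ p) * ‖y (m - m')‖ₑ)) *
            (if m'.2 = 0 ∨ m.2 - m'.2 = 0 then 0 else
              ENNReal.ofReal ((Λ m')⁻¹ * (sobolevWeight 1 (m.2 - m'.2) * (Λ (m - m')) ^ (θ - 1))))) := by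
  rw [enorm_cw, enorm_cw]
  by_cases h : m'.2 = 0 ∨ m.2 - m'.2 = 0
  · have h0 := majorant_term_eq_zero x y hx hy h
    have : ENNReal.ofReal ((Λ m) ^ (p + θ)) * (ENNReal.ofReal ((Λ m')⁻¹) * ‖x m'‖ₑ *
        (ENNReal.ofReal (sobolevWeight 1 (m.2 - m'.2)) * (ENNReal.ofReal ((Λ (m - m'))⁻¹) * ‖y (m - m')‖ₑ))) =
        (ENNReal.ofReal ((Λ m) ^ (p + θ)) * ENNReal.ofReal ((Λ m')⁻¹) *
          ENNReal.ofReal (sobolevWeight 1 (m.2 - m'.2)) * ENNReal.ofReal ((Λ (m - m'))⁻¹)) *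
          (‖x m'‖ₑ * ‖y (m - m')‖ₑ) := by ring
    rw [this, h0, mul_zero]
    exact bot_le
  · obtain ⟨h1, h2⟩ := not_or.1 h
    rw [if_neg h, if_neg h]
    have hL' : 0 < Λ m' := wt_pos h1
    have hL'' : 0 < Λ (m - m') := wt_pos (m := m - m') h2
    have hw : 0 < sobolevWeight 1 (m.2 - m'.2) := sobolevWeight_pos 1 _
    have h4 : 0 ≤ (4 : ℝ) ^ (p + θ) := Real.rpow_nonneg (by norm_num) _
    have hq : 0 ≤ p + θ := add_nonneg hp hθ
    -- the real inequality
    have e1 : (Λ m') ^ (p + θ) = (Λ m') ^ p * ((Λ m') ^ (θ - 1) * Λ m') := by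
      rw [Real.rpow_add hL', Real.rpow_sub_one hL'.ne', div_mul_cancel₀ _ hL'.ne']
    have e2 : (Λ (m - m')) ^ (p + θ) = (Λ (m - m')) ^ p * ((Λ (m - m')) ^ (θ - 1) * Λ (m - m')) := by
      rw [Real.rpow_add hL'', Real.rpow_sub_one hL''.ne', div_mul_cancel₀ _ hL''.ne']
    have hreal : (Λ m) ^ (p + θ) * ((Λ m')⁻¹ * (sobolevWeight 1 (m.2 - m'.2) * (Λ (m - m'))⁻¹)) ≤
        (4 : ℝ) ^ (p + θ) * ((Λ m') ^ p * ((Λ m') ^ (θ - 1) * (sobolevWeight 1 (m.2 - m'.2) * (Λ (m - m'))⁻¹)) +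
          (Λ (m - m')) ^ p * ((Λ m')⁻¹ * (sobolevWeight 1 (m.2 - m'.2) * (Λ (m - m')) ^ (θ - 1)))) := by
      have hD : 0 ≤ (Λ m')⁻¹ * (sobolevWeight 1 (m.2 - m'.2) * (Λ (m - m'))⁻¹) := by positivity
      calc (Λ m) ^ (p + θ) * ((Λ m')⁻¹ * (sobolevWeight 1 (m.2 - m'.2) * (Λ (m - m'))⁻¹))
          ≤ ((4 : ℝ) ^ (p + θ) * ((Λ m') ^ (p + θ) + (Λ (m - m')) ^ (p + θ))) *
            ((Λ m')⁻¹ * (sobolevWeight 1 (m.2 - m'.2) * (Λ (m - m'))⁻¹)) :=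
            mul_le_mul_of_nonneg_right (wt_rpow_le hq m m') hD
        _ = (4 : ℝ) ^ (p + θ) * ((Λ m') ^ p * ((Λ m') ^ (θ - 1) * (sobolevWeight 1 (m.2 - m'.2) * (Λ (m - m'))⁻¹)) +
          (Λ (m - m')) ^ p * ((Λ m')⁻¹ * (sobolevWeight 1 (m.2 - m'.2) * (Λ (m - m')) ^ (θ - 1)))) := by
            rw [e1, e2]
            field_simp
    -- transport to `ℝ≥0∞`
    have hxp : 0 ≤ (Λ m) ^ (p + θ) := wt_rpow_nonneg _ _
    have hi' : 0 ≤ (Λ m')⁻¹ := inv_nonneg.2 hL'.le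
    have hi'' : 0 ≤ (Λ (m - m'))⁻¹ := inv_nonneg.2 hL''.le
    have hp' : 0 ≤ (Λ m') ^ p := wt_rpow_nonneg _ _
    have hp'' : 0 ≤ (Λ (m - m')) ^ p := wt_rpow_nonneg _ _
    have ht' : 0 ≤ (Λ m') ^ (θ - 1) := wt_rpow_nonneg _ _
    have ht'' : 0 ≤ (Λ (m - m')) ^ (θ - 1) := wt_rpow_nonneg _ _
    calc ENNReal.ofReal ((Λ m) ^ (p + θ)) * (ENNReal.ofReal ((Λ m')⁻¹) * ‖x m'‖ₑ *
          (ENNReal.ofReal (sobolevWeight 1 (m.2 - m'.2)) * (ENNReal.ofReal ((Λ (m - m'))⁻¹) * ‖y (m - m')‖ₑ)))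
        = ENNReal.ofReal ((Λ m) ^ (p + θ) * ((Λ m')⁻¹ * (sobolevWeight 1 (m.2 - m'.2) * (Λ (m - m'))⁻¹))) *
            (‖x m'‖ₑ * ‖y (m - m')‖ₑ) := by
          rw [ENNReal.ofReal_mul hxp, ENNReal.ofReal_mul hi', ENNReal.ofReal_mul hw.le]
          ring
      _ ≤ ENNReal.ofReal ((4 : ℝ) ^ (p + θ) * ((Λ m') ^ p * ((Λ m') ^ (θ - 1) *
            (sobolevWeight 1 (m.2 - m'.2) * (Λ (m - m'))⁻¹)) +
            (Λ (m - m')) ^ p * ((Λ m')⁻¹ * (sobolevWeight 1 (m.2 - m'.2) * (Λ (m - m')) ^ (θ - 1))))) *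
            (‖x m'‖ₑ * ‖y (m - m')‖ₑ) := by
          gcongr
      _ = ENNReal.ofReal ((4 : ℝ) ^ (p + θ)) *
          ((ENNReal.ofReal ((Λ m') ^ p) * ‖x m'‖ₑ * ‖y (m - m')‖ₑ) *
            ENNReal.ofReal ((Λ m') ^ (θ - 1) * (sobolevWeight 1 (m.2 - m'.2) * (Λ (m - m'))⁻¹)) +
          (‖x m'‖ₑ * (ENNReal.ofReal ((Λ (m - m')) ^ p) * ‖y (m - m')‖ₑ)) *
            ENNReal.ofReal ((Λ m')⁻¹ * (sobolevWeight 1 (m.2 - m'.2) * (Λ (m - m')) ^ (θ - 1)))) := by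
          rw [ENNReal.ofReal_mul h4, ENNReal.ofReal_add (by positivity) (by positivity),
            ENNReal.ofReal_mul hp', ENNReal.ofReal_mul hp'']
          ring

/-- The square of gain kernel A is the summand of `tsum_gainKernelA_le`. [folklore] -/
theorem gainKernelA_sq_eq (m m' : ℤ × (Fin 3 → ℤ)) :
    (if m'.2 = 0 ∨ m.2 - m'.2 = 0 then (0 : ℝ≥0∞) else
        ENNReal.ofReal ((Λ m') ^ (θ - 1) * (sobolevWeight 1 (m.2 - m'.2) * (Λ (m - m'))⁻¹))) ^ 2 =
      (if m'.2 = 0 ∨ m.2 - m'.2 = 0 then 0 else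
        ENNReal.ofReal ((Λ m') ^ (2 * θ - 2) *
          (sobolevWeight 1 (m.2 - m'.2) ^ 2 * ((Λ (m - m')) ^ 2)⁻¹))) := by
  split_ifs with h
  · simp
  · rw [← ENNReal.ofReal_pow (mul_nonneg (wt_rpow_nonneg _ _)
      (mul_nonneg (sobolevWeight_pos 1 _).le (inv_nonneg.2 (wt_nonneg _))))]
    congr 1
    have e : (Λ m') ^ (2 * θ - 2) = ((Λ m') ^ (θ - 1)) ^ 2 := by
      rw [show 2 * θ - 2 = (θ - 1) * 2 by ring, Real.rpow_mul (wt_nonneg m'), Real.rpow_two]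
    rw [mul_pow, mul_pow, inv_pow, e]

/-- The square of gain kernel B is the summand of `tsum_gainKernelB_le`. [folklore] -/
theorem gainKernelB_sq_eq (m m' : ℤ × (Fin 3 → ℤ)) :
    (if m'.2 = 0 ∨ m.2 - m'.2 = 0 then (0 : ℝ≥0∞) else
        ENNReal.ofReal ((Λ m')⁻¹ * (sobolevWeight 1 (m.2 - m'.2) * (Λ (m - m')) ^ (θ - 1)))) ^ 2 =
      (if m'.2 = 0 ∨ m.2 - m'.2 = 0 then 0 else
        ENNReal.ofReal (((Λ m') ^ 2)⁻¹ *
          (sobolevWeight 1 (m.2 - m'.2) ^ 2 * (Λ (m - m')) ^ (2 * θ - 2)))) := by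
  split_ifs with h
  · simp
  · rw [← ENNReal.ofReal_pow (mul_nonneg (inv_nonneg.2 (wt_nonneg _))
      (mul_nonneg (sobolevWeight_pos 1 _).le (wt_rpow_nonneg _ _)))]
    congr 1
    have e : (Λ (m - m')) ^ (2 * θ - 2) = ((Λ (m - m')) ^ (θ - 1)) ^ 2 := by
      rw [show 2 * θ - 2 = (θ - 1) * 2 by ring, Real.rpow_mul (wt_nonneg (m - m')), Real.rpow_two]
    rw [mul_pow, mul_pow, inv_pow, e]

/-- **The weighted majorant is square-bounded by the two gain kernels**: for every `m`,
`(Λ(m)^{p+θ} ∑_{m'} ‖(x/Λ)(m')‖⟨k''⟩‖(y/Λ)(m'')‖)² ≤ 4^{2(p+θ)}·2·12 S_θ ·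
  [∑_{m'} (Λ'^p‖x'‖‖y''‖)² + ∑_{m'} (‖x'‖Λ''^p‖y''‖)²]`. [folklore] -/
theorem gain_majorant_sq_le {p : ℝ} (hp : 0 ≤ p) (hθ : 0 ≤ θ) (hθ2 : θ ≤ 1 / 2)
    (x y : ℤ × (Fin 3 → ℤ) → EuclideanSpace ℂ (Fin 3))
    (hx : ∀ n : ℤ, x (n, 0) = 0) (hy : ∀ n : ℤ, y (n, 0) = 0) (m : ℤ × (Fin 3 → ℤ)) :
    (ENNReal.ofReal ((Λ m) ^ (p + θ)) * ∑' m' : ℤ × (Fin 3 → ℤ), ‖(𝐜 x) m'‖ₑ *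
        (ENNReal.ofReal (sobolevWeight 1 (m.2 - m'.2)) * ‖(𝐜 y) (m - m')‖ₑ)) ^ 2 ≤
      ENNReal.ofReal ((4 : ℝ) ^ (p + θ)) ^ 2 *
        (2 * ((12 * ∑' k : (Fin 3 → ℤ), ENNReal.ofReal ((freqNormSq k) ^ (2 * θ - 2))) *
          ((∑' m' : ℤ × (Fin 3 → ℤ), (ENNReal.ofReal ((Λ m') ^ p) * ‖x m'‖ₑ * ‖y (m - m')‖ₑ) ^ 2) +
            ∑' m' : ℤ × (Fin 3 → ℤ), (‖x m'‖ₑ * (ENNReal.ofReal ((Λ (m - m')) ^ p) * ‖y (m - m')‖ₑ)) ^ 2))) := by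
  set S : ℝ≥0∞ := ∑' k : (Fin 3 → ℤ), ENNReal.ofReal ((freqNormSq k) ^ (2 * θ - 2)) with hS
  set KA : ℤ × (Fin 3 → ℤ) → ℝ≥0∞ := fun m' => if m'.2 = 0 ∨ m.2 - m'.2 = 0 then 0 else
    ENNReal.ofReal ((Λ m') ^ (θ - 1) * (sobolevWeight 1 (m.2 - m'.2) * (Λ (m - m'))⁻¹)) with hKA
  set KB : ℤ × (Fin 3 → ℤ) → ℝ≥0∞ := fun m' => if m'.2 = 0 ∨ m.2 - m'.2 = 0 then 0 else
    ENNReal.ofReal ((Λ m')⁻¹ * (sobolevWeight 1 (m.2 - m'.2) * (Λ (m - m')) ^ (θ - 1))) with hKB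
  set FA : ℤ × (Fin 3 → ℤ) → ℝ≥0∞ := fun m' => ENNReal.ofReal ((Λ m') ^ p) * ‖x m'‖ₑ * ‖y (m - m')‖ₑ with hFA
  set FB : ℤ × (Fin 3 → ℤ) → ℝ≥0∞ := fun m' => ‖x m'‖ₑ * (ENNReal.ofReal ((Λ (m - m')) ^ p) * ‖y (m - m')‖ₑ) with hFB
  -- push the weight inside and factorise
  have h1 : ENNReal.ofReal ((Λ m) ^ (p + θ)) * ∑' m' : ℤ × (Fin 3 → ℤ), ‖(𝐜 x) m'‖ₑ *
      (ENNReal.ofReal (sobolevWeight 1 (m.2 - m'.2)) * ‖(𝐜 y) (m - m')‖ₑ) ≤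
      ENNReal.ofReal ((4 : ℝ) ^ (p + θ)) * ((∑' m', FA m' * KA m') + ∑' m', FB m' * KB m') := by
    rw [← ENNReal.tsum_mul_left, ← ENNReal.tsum_add, ← ENNReal.tsum_mul_left]
    refine ENNReal.tsum_le_tsum fun m' => ?_
    have := gain_majorant_le hp hθ x y hx hy m m'
    simpa only [hFA, hKA, hFB, hKB, mul_add] using this
  -- Cauchy–Schwarz on each piece
  have hA : (∑' m', FA m' * KA m') ^ 2 ≤ (6 * S) * ∑' m', FA m' ^ 2 := by
    refine (tsum_mul_sq_le FA KA).trans ?_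
    rw [mul_comm]
    gcongr
    rw [tsum_congr (fun m' => gainKernelA_sq_eq (θ := θ) m m')]
    exact tsum_gainKernelA_le (by linarith) m
  have hB : (∑' m', FB m' * KB m') ^ 2 ≤ (12 * S) * ∑' m', FB m' ^ 2 := by
    refine (tsum_mul_sq_le FB KB).trans ?_
    rw [mul_comm]
    gcongr
    rw [tsum_congr (fun m' => gainKernelB_sq_eq (θ := θ) m m')]
    exact tsum_gainKernelB_le hθ2 m
  have hA' : (∑' m', FA m' * KA m') ^ 2 ≤ (12 * S) * ∑' m', FA m' ^ 2 := by
    refine hA.trans ?_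
    gcongr
    norm_num
  calc (ENNReal.ofReal ((Λ m) ^ (p + θ)) * ∑' m' : ℤ × (Fin 3 → ℤ), ‖(𝐜 x) m'‖ₑ *
        (ENNReal.ofReal (sobolevWeight 1 (m.2 - m'.2)) * ‖(𝐜 y) (m - m')‖ₑ)) ^ 2
      ≤ (ENNReal.ofReal ((4 : ℝ) ^ (p + θ)) * ((∑' m', FA m' * KA m') + ∑' m', FB m' * KB m')) ^ 2 :=
        pow_le_pow_left' h1 2
    _ = ENNReal.ofReal ((4 : ℝ) ^ (p + θ)) ^ 2 * ((∑' m', FA m' * KA m') + ∑' m', FB m' * KB m') ^ 2 := by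
        rw [mul_pow]
    _ ≤ ENNReal.ofReal ((4 : ℝ) ^ (p + θ)) ^ 2 *
          (2 * ((∑' m', FA m' * KA m') ^ 2 + (∑' m', FB m' * KB m') ^ 2)) := by
        gcongr
        exact FourierProductLaw.ennreal_add_sq_le_two_mul _ _
    _ ≤ ENNReal.ofReal ((4 : ℝ) ^ (p + θ)) ^ 2 *
          (2 * ((12 * S) * (∑' m', FA m' ^ 2) + (12 * S) * ∑' m', FB m' ^ 2)) := by
        gcongr
    _ = ENNReal.ofReal ((4 : ℝ) ^ (p + θ)) ^ 2 *
          (2 * ((12 * S) * ((∑' m', FA m' ^ 2) + ∑' m', FB m' ^ 2))) := by ring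

/-- **The `θ`-gain estimate** (the product of two fields of the maximal-regularity class
weighted by `Λ^p` lies in the class `∑ Λ^{2(p+θ)}|·|² < ∞`, `θ < 1/4`): for families `x`, `y` on
`ℤ × ℤ³` vanishing on the zero spatial modes, `p ≥ 0`, `0 ≤ θ ≤ 1/2`,
`∑_m Λ(m)^{2(p+θ)} ‖N(x/Λ, y/Λ)(m)‖² ≤ (18π)²·4^{2(p+θ)}·24 S_θ ·
   [ (∑Λ^{2p}‖x‖²)(∑‖y‖²) + (∑‖x‖²)(∑Λ^{2p}‖y‖²) ]`, `S_θ = ∑_k (|k|²)^{2θ−2}`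
(the kernel bounds of §B‴ and Cauchy–Schwarz; Iooss 1972, §2, and Kielhöfer 2012, §I.8, use the
equivalent parabolic `L^p`/Hölder bootstrap). [folklore] -/
theorem tsum_rpow_wt_mul_enorm_nl_sq_le {p : ℝ} (hp : 0 ≤ p) (hθ : 0 ≤ θ) (hθ2 : θ ≤ 1 / 2)
    (x y : ℤ × (Fin 3 → ℤ) → EuclideanSpace ℂ (Fin 3))
    (hx : ∀ n : ℤ, x (n, 0) = 0) (hy : ∀ n : ℤ, y (n, 0) = 0) :
    ∑' m : ℤ × (Fin 3 → ℤ), ENNReal.ofReal ((Λ m) ^ (2 * (p + θ))) * ‖𝐍[𝐜 x, 𝐜 y] m‖ₑ ^ 2 ≤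
      ENNReal.ofReal (18 * Real.pi) ^ 2 * (ENNReal.ofReal ((4 : ℝ) ^ (p + θ)) ^ 2 *
        (2 * (12 * ∑' k : (Fin 3 → ℤ), ENNReal.ofReal ((freqNormSq k) ^ (2 * θ - 2))))) *
        ((∑' m : ℤ × (Fin 3 → ℤ), ENNReal.ofReal ((Λ m) ^ (2 * p)) * ‖x m‖ₑ ^ 2) *
            (∑' m : ℤ × (Fin 3 → ℤ), ‖y m‖ₑ ^ 2) +
          (∑' m : ℤ × (Fin 3 → ℤ), ‖x m‖ₑ ^ 2) *
            ∑' m : ℤ × (Fin 3 → ℤ), ENNReal.ofReal ((Λ m) ^ (2 * p)) * ‖y m‖ₑ ^ 2) := by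
  set S12 : ℝ≥0∞ := 12 * ∑' k : (Fin 3 → ℤ), ENNReal.ofReal ((freqNormSq k) ^ (2 * θ - 2)) with hS12
  set C4 : ℝ≥0∞ := ENNReal.ofReal ((4 : ℝ) ^ (p + θ)) ^ 2 with hC4
  set FA : ℤ × (Fin 3 → ℤ) → ℝ≥0∞ := fun m' => ENNReal.ofReal ((Λ m') ^ p) * ‖x m'‖ₑ with hFA
  set GB : ℤ × (Fin 3 → ℤ) → ℝ≥0∞ := fun l => ENNReal.ofReal ((Λ l) ^ p) * ‖y l‖ₑ with hGB
  -- pointwise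
  have hpt : ∀ m : ℤ × (Fin 3 → ℤ), ENNReal.ofReal ((Λ m) ^ (2 * (p + θ))) * ‖𝐍[𝐜 x, 𝐜 y] m‖ₑ ^ 2 ≤
      ENNReal.ofReal (18 * Real.pi) ^ 2 * (C4 * (2 * (S12 *
        ((∑' m' : ℤ × (Fin 3 → ℤ), (FA m' * ‖y (m - m')‖ₑ) ^ 2) +
          ∑' m' : ℤ × (Fin 3 → ℤ), (‖x m'‖ₑ * GB (m - m')) ^ 2)))) := by
    intro m
    have h1 := enorm_nl_le (𝐜 x) (𝐜 y) m
    have h2 := gain_majorant_sq_le hp hθ hθ2 x y hx hy m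
    calc ENNReal.ofReal ((Λ m) ^ (2 * (p + θ))) * ‖𝐍[𝐜 x, 𝐜 y] m‖ₑ ^ 2
        = (ENNReal.ofReal ((Λ m) ^ (p + θ)) * ‖𝐍[𝐜 x, 𝐜 y] m‖ₑ) ^ 2 := by
          rw [ofReal_wt_rpow_two_mul, mul_pow]
      _ ≤ (ENNReal.ofReal ((Λ m) ^ (p + θ)) * (ENNReal.ofReal (18 * Real.pi) *
          ∑' m' : ℤ × (Fin 3 → ℤ), ‖(𝐜 x) m'‖ₑ *
            (ENNReal.ofReal (sobolevWeight 1 (m.2 - m'.2)) * ‖(𝐜 y) (m - m')‖ₑ))) ^ 2 := by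
          gcongr
      _ = ENNReal.ofReal (18 * Real.pi) ^ 2 * (ENNReal.ofReal ((Λ m) ^ (p + θ)) *
          ∑' m' : ℤ × (Fin 3 → ℤ), ‖(𝐜 x) m'‖ₑ *
            (ENNReal.ofReal (sobolevWeight 1 (m.2 - m'.2)) * ‖(𝐜 y) (m - m')‖ₑ)) ^ 2 := by ring
      _ ≤ ENNReal.ofReal (18 * Real.pi) ^ 2 * (C4 * (2 * (S12 *
          ((∑' m' : ℤ × (Fin 3 → ℤ), (FA m' * ‖y (m - m')‖ₑ) ^ 2) +
            ∑' m' : ℤ × (Fin 3 → ℤ), (‖x m'‖ₑ * GB (m - m')) ^ 2)))) := by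
          gcongr
  -- sum in `m`
  have hsumA : ∑' (m : ℤ × (Fin 3 → ℤ)) (m' : ℤ × (Fin 3 → ℤ)), (FA m' * ‖y (m - m')‖ₑ) ^ 2 =
      (∑' m, ENNReal.ofReal ((Λ m) ^ (2 * p)) * ‖x m‖ₑ ^ 2) * ∑' m, ‖y m‖ₑ ^ 2 := by
    rw [tsum_tsum_mul_sq_eq FA (fun l => ‖y l‖ₑ)]
    congr 1
    refine tsum_congr fun m => ?_
    rw [hFA, mul_pow, ofReal_wt_rpow_two_mul]
  have hsumB : ∑' (m : ℤ × (Fin 3 → ℤ)) (m' : ℤ × (Fin 3 → ℤ)), (‖x m'‖ₑ * GB (m - m')) ^ 2 =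
      (∑' m, ‖x m‖ₑ ^ 2) * ∑' m, ENNReal.ofReal ((Λ m) ^ (2 * p)) * ‖y m‖ₑ ^ 2 := by
    rw [tsum_tsum_mul_sq_eq (fun l => ‖x l‖ₑ) GB]
    congr 1
    refine tsum_congr fun m => ?_
    rw [hGB, mul_pow, ofReal_wt_rpow_two_mul]
  calc ∑' m : ℤ × (Fin 3 → ℤ), ENNReal.ofReal ((Λ m) ^ (2 * (p + θ))) * ‖𝐍[𝐜 x, 𝐜 y] m‖ₑ ^ 2
      ≤ ∑' m : ℤ × (Fin 3 → ℤ), ENNReal.ofReal (18 * Real.pi) ^ 2 * (C4 * (2 * (S12 *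
          ((∑' m' : ℤ × (Fin 3 → ℤ), (FA m' * ‖y (m - m')‖ₑ) ^ 2) +
            ∑' m' : ℤ × (Fin 3 → ℤ), (‖x m'‖ₑ * GB (m - m')) ^ 2)))) := ENNReal.tsum_le_tsum hpt
    _ = ENNReal.ofReal (18 * Real.pi) ^ 2 * (C4 * (2 * (S12 *
          ((∑' (m : ℤ × (Fin 3 → ℤ)) (m' : ℤ × (Fin 3 → ℤ)), (FA m' * ‖y (m - m')‖ₑ) ^ 2) +
            ∑' (m : ℤ × (Fin 3 → ℤ)) (m' : ℤ × (Fin 3 → ℤ)), (‖x m'‖ₑ * GB (m - m')) ^ 2)))) := by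
        rw [ENNReal.tsum_mul_left, ENNReal.tsum_mul_left, ENNReal.tsum_mul_left, ENNReal.tsum_mul_left,
          ENNReal.tsum_add]
    _ = _ := by rw [hsumA, hsumB, hS12, hC4]; ring

/-- The constant of the gain estimate is finite for `θ < 1/4`. [folklore] -/
theorem gainEstConst_ne_top {p : ℝ} (hθ : 0 ≤ θ) (hθ4 : θ < 1 / 4) :
    ENNReal.ofReal (18 * Real.pi) ^ 2 * (ENNReal.ofReal ((4 : ℝ) ^ (p + θ)) ^ 2 *
        (2 * (12 * ∑' k : (Fin 3 → ℤ), ENNReal.ofReal ((freqNormSq k) ^ (2 * θ - 2))))) ≠ ∞ :=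
  ENNReal.mul_ne_top (ENNReal.pow_ne_top ENNReal.ofReal_ne_top)
    (ENNReal.mul_ne_top (ENNReal.pow_ne_top ENNReal.ofReal_ne_top)
      (ENNReal.mul_ne_top (by norm_num) (ENNReal.mul_ne_top (by norm_num) (gainConst_ne_top hθ hθ4))))

/-- **Finiteness form of the gain estimate**: if `∑Λ^{2p}‖x‖², ∑‖x‖², ∑Λ^{2p}‖y‖², ∑‖y‖²` are
finite then so is `∑ Λ^{2(p+θ)} ‖N(x/Λ, y/Λ)‖²` (`θ < 1/4`). [folklore] -/
theorem tsum_rpow_wt_mul_enorm_nl_sq_ne_top {p : ℝ} (hp : 0 ≤ p) (hθ : 0 ≤ θ) (hθ4 : θ < 1 / 4)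
    (x y : ℤ × (Fin 3 → ℤ) → EuclideanSpace ℂ (Fin 3))
    (hx : ∀ n : ℤ, x (n, 0) = 0) (hy : ∀ n : ℤ, y (n, 0) = 0)
    (hx2 : ∑' m, ‖x m‖ₑ ^ 2 ≠ ∞) (hy2 : ∑' m, ‖y m‖ₑ ^ 2 ≠ ∞)
    (hxp : ∑' m, ENNReal.ofReal ((Λ m) ^ (2 * p)) * ‖x m‖ₑ ^ 2 ≠ ∞)
    (hyp : ∑' m, ENNReal.ofReal ((Λ m) ^ (2 * p)) * ‖y m‖ₑ ^ 2 ≠ ∞) :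
    ∑' m : ℤ × (Fin 3 → ℤ), ENNReal.ofReal ((Λ m) ^ (2 * (p + θ))) * ‖𝐍[𝐜 x, 𝐜 y] m‖ₑ ^ 2 ≠ ∞ := by
  refine ne_top_of_le_ne_top ?_ (tsum_rpow_wt_mul_enorm_nl_sq_le hp hθ (by linarith) x y hx hy)
  exact ENNReal.mul_ne_top (gainEstConst_ne_top hθ hθ4)
    (ENNReal.add_ne_top.2 ⟨ENNReal.mul_ne_top hxp hy2, ENNReal.mul_ne_top hx2 hyp⟩)

end Gain

/-! ## §D‴ The bootstrap: solutions of the lattice equations are rapidly decreasing -/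

section Bootstrap

/-- **Pointwise step**: from
`c‖x(m)‖ ≤ ‖y(m)‖ + ‖N₁(m)‖ + ‖N₂(m)‖ + ‖N₃(m)‖` (norms in `ℝ`, `c ≥ 0`) to
`(ofReal c)² w‖x(m)‖² ≤ 4 w(‖y‖² + ‖N₁‖² + ‖N₂‖² + ‖N₃‖²)` in `ℝ≥0∞`. [folklore] -/
theorem bootstrap_pointwise {c : ℝ} {w : ℝ≥0∞} {X Y N₁ N₂ N₃ : EuclideanSpace ℂ (Fin 3)}
    (h : c * ‖X‖ ≤ ‖Y‖ + ‖N₁‖ + ‖N₂‖ + ‖N₃‖) (hc : 0 ≤ c) :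
    ENNReal.ofReal c ^ 2 * (w * ‖X‖ₑ ^ 2) ≤
      4 * (w * (‖Y‖ₑ ^ 2 + ‖N₁‖ₑ ^ 2 + ‖N₂‖ₑ ^ 2 + ‖N₃‖ₑ ^ 2)) := by
  have h1 : ENNReal.ofReal c * ‖X‖ₑ ≤ ‖Y‖ₑ + ‖N₁‖ₑ + ‖N₂‖ₑ + ‖N₃‖ₑ := by
    rw [← ofReal_norm, ← ofReal_norm, ← ofReal_norm, ← ofReal_norm,
      ← ofReal_norm, ← ENNReal.ofReal_mul hc, ← ENNReal.ofReal_add (norm_nonneg _) (norm_nonneg _),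
      ← ENNReal.ofReal_add (by positivity) (norm_nonneg _),
      ← ENNReal.ofReal_add (by positivity) (norm_nonneg _)]
    exact ENNReal.ofReal_le_ofReal h
  have h2 : (ENNReal.ofReal c * ‖X‖ₑ) ^ 2 ≤ 4 * (‖Y‖ₑ ^ 2 + ‖N₁‖ₑ ^ 2 + ‖N₂‖ₑ ^ 2 + ‖N₃‖ₑ ^ 2) :=
    (pow_le_pow_left' h1 2).trans (FourierNS.add_four_sq_le _ _ _ _)
  calc ENNReal.ofReal c ^ 2 * (w * ‖X‖ₑ ^ 2)
      = w * (ENNReal.ofReal c * ‖X‖ₑ) ^ 2 := by ring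
    _ ≤ w * (4 * (‖Y‖ₑ ^ 2 + ‖N₁‖ₑ ^ 2 + ‖N₂‖ₑ ^ 2 + ‖N₃‖ₑ ^ 2)) := by gcongr
    _ = 4 * (w * (‖Y‖ₑ ^ 2 + ‖N₁‖ₑ ^ 2 + ‖N₂‖ₑ ^ 2 + ‖N₃‖ₑ ^ 2)) := by ring

/-- **One step of the bootstrap**: if `x ∈ ℓ²` has the moment `∑Λ^{2p}|x|² < ∞` (`p ≥ 0`),
`x₀` and `y` have all moments, and `c‖x(m)‖ ≤ ‖y(m)‖ + ‖N(x/Λ,x/Λ)(m)‖ + ‖N(x₀/Λ,x/Λ)(m)‖ +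
‖N(x/Λ,x₀/Λ)(m)‖` off `k = 0`, then `∑Λ^{2(p+θ)}|x|² < ∞` for `0 ≤ θ < 1/4`. [folklore] -/
theorem bootstrap_step {θ p c : ℝ} (hθ : 0 ≤ θ) (hθ4 : θ < 1 / 4) (hp : 0 ≤ p) (hc : 0 < c)
    (x x₀ y : ℤ × (Fin 3 → ℤ) → EuclideanSpace ℂ (Fin 3))
    (hx : ∀ n : ℤ, x (n, 0) = 0) (hx₀ : ∀ n : ℤ, x₀ (n, 0) = 0)
    (hx2 : ∑' m, ‖x m‖ₑ ^ 2 ≠ ∞)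
    (hx₀s : ∀ N : ℕ, ∑' m, ENNReal.ofReal ((Λ m) ^ N) * ‖x₀ m‖ₑ ^ 2 ≠ ∞)
    (hys : ∀ N : ℕ, ∑' m, ENNReal.ofReal ((Λ m) ^ N) * ‖y m‖ₑ ^ 2 ≠ ∞)
    (heq : ∀ m : ℤ × (Fin 3 → ℤ), m.2 ≠ 0 →
      c * ‖x m‖ ≤ ‖y m‖ + ‖𝐍[𝐜 x, 𝐜 x] m‖ + ‖𝐍[𝐜 x₀, 𝐜 x] m‖ + ‖𝐍[𝐜 x, 𝐜 x₀] m‖)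
    (hxp : ∑' m, ENNReal.ofReal ((Λ m) ^ (2 * p)) * ‖x m‖ₑ ^ 2 ≠ ∞) :
    ∑' m, ENNReal.ofReal ((Λ m) ^ (2 * (p + θ))) * ‖x m‖ₑ ^ 2 ≠ ∞ := by
  -- the finite right-hand sides
  have hx₀2 : ∑' m, ‖x₀ m‖ₑ ^ 2 ≠ ∞ := by
    have := hx₀s 0
    simpa only [pow_zero, ENNReal.ofReal_one, one_mul] using this
  have hx₀p : ∑' m, ENNReal.ofReal ((Λ m) ^ (2 * p)) * ‖x₀ m‖ₑ ^ 2 ≠ ∞ := tsum_rpow_wt_mul_ne_top hp hx₀s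
  have hyq : ∑' m, ENNReal.ofReal ((Λ m) ^ (2 * (p + θ))) * ‖y m‖ₑ ^ 2 ≠ ∞ :=
    tsum_rpow_wt_mul_ne_top (by linarith) hys
  have hN1 := tsum_rpow_wt_mul_enorm_nl_sq_ne_top hp hθ hθ4 x x hx hx hx2 hx2 hxp hxp
  have hN2 := tsum_rpow_wt_mul_enorm_nl_sq_ne_top hp hθ hθ4 x₀ x hx₀ hx hx₀2 hx2 hx₀p hxp
  have hN3 := tsum_rpow_wt_mul_enorm_nl_sq_ne_top hp hθ hθ4 x x₀ hx hx₀ hx2 hx₀2 hxp hx₀p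
  -- pointwise inequality, valid at all modes
  have hpt : ∀ m : ℤ × (Fin 3 → ℤ),
      ENNReal.ofReal c ^ 2 * (ENNReal.ofReal ((Λ m) ^ (2 * (p + θ))) * ‖x m‖ₑ ^ 2) ≤
      4 * (ENNReal.ofReal ((Λ m) ^ (2 * (p + θ))) * (‖y m‖ₑ ^ 2 + ‖𝐍[𝐜 x, 𝐜 x] m‖ₑ ^ 2 +
        ‖𝐍[𝐜 x₀, 𝐜 x] m‖ₑ ^ 2 + ‖𝐍[𝐜 x, 𝐜 x₀] m‖ₑ ^ 2)) := by
    intro m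
    by_cases hm : m.2 = 0
    · have : x m = 0 := by
        have := hx m.1
        rwa [show ((m.1, 0) : ℤ × (Fin 3 → ℤ)) = m from Prod.ext rfl hm.symm] at this
      rw [this, enorm_zero, zero_pow two_ne_zero, mul_zero, mul_zero]
      exact bot_le
    · exact bootstrap_pointwise (heq m hm) hc.le
  have hsum : ENNReal.ofReal c ^ 2 * ∑' m, ENNReal.ofReal ((Λ m) ^ (2 * (p + θ))) * ‖x m‖ₑ ^ 2 ≤
      4 * ((∑' m, ENNReal.ofReal ((Λ m) ^ (2 * (p + θ))) * ‖y m‖ₑ ^ 2) +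
        (∑' m, ENNReal.ofReal ((Λ m) ^ (2 * (p + θ))) * ‖𝐍[𝐜 x, 𝐜 x] m‖ₑ ^ 2) +
        (∑' m, ENNReal.ofReal ((Λ m) ^ (2 * (p + θ))) * ‖𝐍[𝐜 x₀, 𝐜 x] m‖ₑ ^ 2) +
        ∑' m, ENNReal.ofReal ((Λ m) ^ (2 * (p + θ))) * ‖𝐍[𝐜 x, 𝐜 x₀] m‖ₑ ^ 2) := by
    rw [← ENNReal.tsum_mul_left, ← ENNReal.tsum_add, ← ENNReal.tsum_add, ← ENNReal.tsum_add,
      ← ENNReal.tsum_mul_left]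
    refine ENNReal.tsum_le_tsum fun m => ?_
    refine (hpt m).trans (le_of_eq ?_)
    ring
  have hfin : ENNReal.ofReal c ^ 2 * ∑' m, ENNReal.ofReal ((Λ m) ^ (2 * (p + θ))) * ‖x m‖ₑ ^ 2 ≠ ∞ := by
    refine ne_top_of_le_ne_top ?_ hsum
    refine ENNReal.mul_ne_top (by norm_num) ?_
    exact ENNReal.add_ne_top.2 ⟨ENNReal.add_ne_top.2 ⟨ENNReal.add_ne_top.2 ⟨hyq, hN1⟩, hN2⟩, hN3⟩
  have hc2 : ENNReal.ofReal c ^ 2 ≠ 0 := pow_ne_zero 2 (by simpa using hc)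
  intro htop
  rw [htop, ENNReal.mul_top hc2] at hfin
  exact hfin rfl

/-- **Parabolic bootstrap on the lattice** (Fourier side of the regularity of time-periodic
solutions; Kielhöfer 2012, §I.8, "by a bootstrapping argument"; Henry 1981, §3.5): let `x` be a
square-summable family on `ℤ × ℤ³` vanishing on the zero spatial modes, let `x₀`, `y` vanish
there too (`x₀`) and have all parabolic moments `∑ Λ^N |·|² < ∞`, and suppose that off `k = 0`
`c‖x(m)‖ ≤ ‖y(m)‖ + ‖N(x/Λ,x/Λ)(m)‖ + ‖N(x₀/Λ,x/Λ)(m)‖ + ‖N(x/Λ,x₀/Λ)(m)‖` with `c > 0` — as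
holds for the solutions of the projected time-periodic Navier–Stokes lattice equation
(`x₀ = 0`, `y` = force) and of its linearisation at a smooth orbit `x₀` (`y` = `0` or `∂ₛx₀`),
by the symbol lower bound `c Λ ≤ |σ|`. Then `x` has all parabolic moments:
`∑_m Λ(m)^N ‖x(m)‖² < ∞` for every `N`, i.e. `x/Λ` is the coefficient family of a smooth
space–time field. [folklore] -/
theorem moments_of_lattice_ineq {c : ℝ} (hc : 0 < c)
    (x x₀ y : ℤ × (Fin 3 → ℤ) → EuclideanSpace ℂ (Fin 3))
    (hx : ∀ n : ℤ, x (n, 0) = 0) (hx₀ : ∀ n : ℤ, x₀ (n, 0) = 0)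
    (hx2 : ∑' m, ‖x m‖ₑ ^ 2 ≠ ∞)
    (hx₀s : ∀ N : ℕ, ∑' m, ENNReal.ofReal ((Λ m) ^ N) * ‖x₀ m‖ₑ ^ 2 ≠ ∞)
    (hys : ∀ N : ℕ, ∑' m, ENNReal.ofReal ((Λ m) ^ N) * ‖y m‖ₑ ^ 2 ≠ ∞)
    (heq : ∀ m : ℤ × (Fin 3 → ℤ), m.2 ≠ 0 →
      c * ‖x m‖ ≤ ‖y m‖ + ‖𝐍[𝐜 x, 𝐜 x] m‖ + ‖𝐍[𝐜 x₀, 𝐜 x] m‖ + ‖𝐍[𝐜 x, 𝐜 x₀] m‖) (N : ℕ) :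
    ∑' m, ENNReal.ofReal ((Λ m) ^ N) * ‖x m‖ₑ ^ 2 ≠ ∞ := by
  -- induction on the fractional level `j/8`
  have hlevel : ∀ j : ℕ, ∑' m, ENNReal.ofReal ((Λ m) ^ (2 * ((j : ℝ) * (1 / 8)))) * ‖x m‖ₑ ^ 2 ≠ ∞ := by
    intro j
    induction j with
    | zero =>
      simpa only [Nat.cast_zero, zero_mul, mul_zero, Real.rpow_zero, ENNReal.ofReal_one, one_mul] using hx2
    | succ j ih =>
      have e : ∀ m : ℤ × (Fin 3 → ℤ), (Λ m) ^ (2 * (((j + 1 : ℕ) : ℝ) * (1 / 8))) =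
          (Λ m) ^ (2 * ((j : ℝ) * (1 / 8) + 1 / 8)) := by
        intro m; congr 1; push_cast; ring
      simp only [e]
      exact bootstrap_step (by norm_num) (by norm_num) (by positivity) hc x x₀ y hx hx₀ hx2 hx₀s hys heq ih
  have h := hlevel (4 * N)
  have e : ∀ m : ℤ × (Fin 3 → ℤ), (Λ m) ^ (2 * (((4 * N : ℕ) : ℝ) * (1 / 8))) = (Λ m) ^ N := by
    intro m
    rw [← Real.rpow_natCast]
    congr 1; push_cast; ring
  simpa only [e] using h

end Bootstrap

end TimePeriodicLattice

end Literature.Analysis.FluidPDE
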